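import Summits.MatrixMultiplication.MatrixMultiplication.Theorems.SaturationLadderTwinCeilingCore
import HarnessLib

/-!
# SaturationLadder — twin-class ceiling (2/3): the pencil of twin families `κ = p/q` — counts, abscissa, entropy hypotheses

Second file of the move `…TwinCeilingCore → …TwinCeilingPencil → …TwinCeiling` on the crux
`SubexpSaturation` (stmt-MatrixMultiplication-25909) of route `SaturationLadder`.  The ONE-PARAMETER
PENCIL of STAGE-2 twin families (letter masses in units of `1/d`, `d = 2^{j+1} + 3`: `3/2 + 1/j` on
`(1,1,0)`, `3/2 + 1/j + κ/j` on `(1,0,1)`, the rest of `2^{j+1}` on `(0,1,1)`, `1/2 − 1/j` on `(0,2,0)`,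
`0` on `(2,0,0)`, `1` on `(0,0,2)`) has, for `κ = p/q`, the natural letter counts `× 2qj`

  `n₁ = 3qj + 2q`, `n₃ = 3qj + 2q + 2p`, `n₂ = 2qj·2^{j+1} − n₃`, `n₄ = qj − 2q`, `n₅ = 0`, `n₆ = 2qj`

(the landed family `SaturationLadderTwinFamily.fN*` is the member `(p, q) = (17, 20)`).  The file is
DEF-FREE: every lemma takes the counts as variables `n₁ … n₆ : ℕ` bound by the COUNT EQUATIONS
`n₁ = 3qj+2q`, `n₂ + (3qj+2q+2p) = 2qj·2^{j+1}`, `n₃ = 3qj+2q+2p`, `n₄ + 2q = qj`, `n₆ = 2qj` (no truncated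
subtraction), so that its conclusion is literally a hypothesis / the abscissa of `omegaRect_one_tw_exact`.

* count arithmetic: `le_cnt_aux` (`n₃ ≤ 2qj·2^{j+1}`), `two_q_le`, `cnt_add₂₃` / `cnt_add₁₄`
  (output-perfectness `n₂ + n₃ = 2^{j+1} n₆`, `n₁ + n₄ + 0 = 2 n₆` for the explicit counts), `cnt₆_pos`,
  `cnt₃_pos`;
* abscissa: `tEq`, `one_sub_t`, `one_sub_t_le` (`1 − t_j ≤ 2/j`), and the growth of the pencil
  `nat_le_pencil_exponent : j ≤ ((3q+2p)/(3q)) · 1/(1 − t_j)` (exact; difference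
  `(9q² + 10pq + 4p²) j + (3q+2p)(2q+2p)`), `two_pow_le_rpow_pencil : 2^j ≤ (2^{(3q+2p)/(3q)})^{1/(1−t_j)}`;
* `paramY`, `paramX` : for `0 < q`, `p ≤ q`, `j ≥ 1000` and `j · δ(p/q) ≥ 30`
  (`δ(κ) = (5/2 + κ) log 2 − (5/2) log (5/2)`), `H(Z_j) ≤ H(Y_j)` and `H(Z_j) ≤ H(X_j)` — the nine
  entries rewrite to `(2, B, 1)/d`, `(α, d − τ, γ)/d`, `(d − σ, σ, 0)/d`, then
  `SaturationLadderTwinCeilingCore.coreY` / `coreX` apply with `κ = p/q`, `ε = 1/j`.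

No definitions, no named facts, no sorry (cell `decomp-mm`, lens 1 «grading / quantitative ladder», gen 14).
-/

set_option linter.dupNamespace false
-- (single-conjunct summit: the namespace repeats `MatrixMultiplication`)

noncomputable section

namespace Summit.MatrixMultiplication.MatrixMultiplication.Theorems.SaturationLadderTwinCeilingPencil

open Literature.Computability.AlgebraicComplexity
open Summit.MatrixMultiplication.MatrixMultiplication.Theorems.SaturationLadderTwinCeilingCore
  (coreY coreX)

/-! ## Count arithmetic of the pencil -/

/-- `3qj + 2q + 2p ≤ 2qj · 2^{j+1}` (`p ≤ q`, `j ≥ 1`): `n₂ = 2qj·2^{j+1} − n₃` is a genuine difference.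
[folklore] -/
theorem le_cnt_aux (p q j : ℕ) (hpq : p ≤ q) (hj : 1 ≤ j) :
    3 * q * j + 2 * q + 2 * p ≤ 2 * q * j * 2 ^ (j + 1) := by
  have h4 : 4 ≤ 2 ^ (j + 1) := by
    calc 4 = 2 ^ 2 := by norm_num
      _ ≤ 2 ^ (j + 1) := Nat.pow_le_pow_right (by norm_num) (by omega)
  have h1 : q ≤ q * j := Nat.le_mul_of_pos_right q hj
  have h2 := Nat.mul_le_mul_left (2 * q * j) h4
  have h0 : 0 ≤ q * j := Nat.zero_le _
  nlinarith [h1, h2, hpq, h0]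

/-- `2q ≤ qj` (`j ≥ 2`): `n₄ = qj − 2q` is a genuine difference. [folklore] -/
theorem two_q_le (q j : ℕ) (hj : 2 ≤ j) : 2 * q ≤ q * j := by
  calc 2 * q = q * 2 := by ring
    _ ≤ q * j := Nat.mul_le_mul_left q hj

/-- output-perfect, second condition, for the explicit counts: `n₂ + n₃ = 2^{j+1} n₆`. [folklore] -/
theorem cnt_add₂₃ (p q j : ℕ) (hpq : p ≤ q) (hj : 1 ≤ j) :
    (2 * q * j * 2 ^ (j + 1) - (3 * q * j + 2 * q + 2 * p)) + (3 * q * j + 2 * q + 2 * p) =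
      2 ^ (j + 1) * (2 * q * j) := by
  rw [Nat.sub_add_cancel (le_cnt_aux p q j hpq hj)]
  ring

/-- output-perfect, first condition, for the explicit counts: `n₁ + n₄ + n₅ = 2 n₆` (`j ≥ 2`).
[folklore] -/
theorem cnt_add₁₄ (q j : ℕ) (hj : 2 ≤ j) :
    3 * q * j + 2 * q + (q * j - 2 * q) + 0 = 2 * (2 * q * j) := by
  zify [two_q_le q j hj]
  ring

/-- `0 < n₆ = 2qj` (`0 < q`, `1 ≤ j`). [folklore] -/
theorem cnt₆_pos (q j : ℕ) (hq : 0 < q) (hj : 1 ≤ j) : 0 < 2 * q * j :=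
  Nat.mul_pos (Nat.mul_pos (by norm_num) hq) (by omega)

/-- `0 < (j+1) n₃ + n₅` (`0 < q`). [folklore] -/
theorem cnt₃_pos (p q j : ℕ) (hq : 0 < q) : 0 < (j + 1) * (3 * q * j + 2 * q + 2 * p) + 0 := by
  rw [add_zero]
  apply Nat.mul_pos (Nat.succ_pos j)
  have h2 : 0 < 2 * q := by omega
  calc 0 < 2 * q := h2
    _ ≤ 3 * q * j + 2 * q := Nat.le_add_left _ _
    _ ≤ 3 * q * j + 2 * q + 2 * p := Nat.le_add_right _ _

/-! ## The abscissa `t_j = j n₁ / ((j+1) n₃ + n₅)` and the growth of the pencil -/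

/-- `t_j = j (3qj+2q) / ((j+1)(3qj+2q+2p))`. [folklore] -/
theorem tEq (p q j n₁ n₃ : ℕ) (h₁ : n₁ = 3 * q * j + 2 * q) (h₃ : n₃ = 3 * q * j + 2 * q + 2 * p) :
    ((j : ℝ) * n₁) / (((j : ℝ) + 1) * n₃ + ((0 : ℕ) : ℝ)) =
      ((j : ℝ) * (3 * q * j + 2 * q)) / (((j : ℝ) + 1) * (3 * q * j + 2 * q + 2 * p)) := by
  subst h₁ h₃; push_cast; ring_nf

/-- `1 − t_j = ((3q+2p) j + 2q + 2p) / ((j+1)(3qj+2q+2p))`. [folklore] -/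
theorem one_sub_t (p q j n₁ n₃ : ℕ) (h₁ : n₁ = 3 * q * j + 2 * q)
    (h₃ : n₃ = 3 * q * j + 2 * q + 2 * p) (hq : 0 < q) :
    1 - ((j : ℝ) * n₁) / (((j : ℝ) + 1) * n₃ + ((0 : ℕ) : ℝ)) =
      ((3 * (q : ℝ) + 2 * p) * j + 2 * q + 2 * p) / (((j : ℝ) + 1) * (3 * q * j + 2 * q + 2 * p)) := by
  rw [tEq p q j n₁ n₃ h₁ h₃]
  have hq' : (0 : ℝ) < q := by exact_mod_cast hq
  have h : (0 : ℝ) < ((j : ℝ) + 1) * (3 * q * j + 2 * q + 2 * p) := by positivity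
  field_simp
  ring

/-- `1 − t_j ≤ 2/j` (`j ≥ 1`, `p ≤ q`). [folklore] -/
theorem one_sub_t_le (p q j n₁ n₃ : ℕ) (h₁ : n₁ = 3 * q * j + 2 * q)
    (h₃ : n₃ = 3 * q * j + 2 * q + 2 * p) (hq : 0 < q) (hpq : p ≤ q) (hj : 1 ≤ j) :
    1 - ((j : ℝ) * n₁) / (((j : ℝ) + 1) * n₃ + ((0 : ℕ) : ℝ)) ≤ 2 / (j : ℝ) := by
  rw [one_sub_t p q j n₁ n₃ h₁ h₃ hq]
  have hq' : (0 : ℝ) < q := by exact_mod_cast hq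
  have hpq' : (p : ℝ) ≤ q := by exact_mod_cast hpq
  have hj' : (1 : ℝ) ≤ j := by exact_mod_cast hj
  rw [div_le_div_iff₀ (by positivity) (by positivity)]
  have h1 : 0 ≤ (3 * (q : ℝ) - 2 * p) * ((j : ℝ) * j) :=
    mul_nonneg (by linarith) (by positivity)
  have h2 : 0 ≤ (q : ℝ) * j := by positivity
  have h3 : 0 ≤ (p : ℝ) * j := by positivity
  nlinarith [h1, h2, h3, hq'.le, (Nat.cast_nonneg p : (0 : ℝ) ≤ p)]

/-- `j ≤ ((3q+2p)/(3q)) · 1/(1 − t_j)`, i.e. `3qj((3q+2p)j + 2q+2p) ≤ (3q+2p)(j+1)(3qj+2q+2p)`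
(difference `(9q² + 10pq + 4p²) j + (3q+2p)(2q+2p)`). [folklore] -/
theorem nat_le_pencil_exponent (p q j n₁ n₃ : ℕ) (h₁ : n₁ = 3 * q * j + 2 * q)
    (h₃ : n₃ = 3 * q * j + 2 * q + 2 * p) (hq : 0 < q) :
    (j : ℝ) ≤ (3 * (q : ℝ) + 2 * p) / (3 * q) *
      (1 / (1 - ((j : ℝ) * n₁) / (((j : ℝ) + 1) * n₃ + ((0 : ℕ) : ℝ)))) := by
  have hq' : (0 : ℝ) < q := by exact_mod_cast hq
  rw [one_sub_t p q j n₁ n₃ h₁ h₃ hq, one_div_div, div_mul_div_comm, le_div_iff₀ (by positivity)]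
  have h0 : (0 : ℝ) ≤ (9 * (q : ℝ) ^ 2 + 10 * p * q + 4 * (p : ℝ) ^ 2) * j +
      (3 * q + 2 * p) * (2 * q + 2 * p) := by positivity
  nlinarith [h0]

/-- `2^j ≤ (2^{(3q+2p)/(3q)})^{1/(1 − t_j)}` for every `j`. [folklore] -/
theorem two_pow_le_rpow_pencil (p q j n₁ n₃ : ℕ) (h₁ : n₁ = 3 * q * j + 2 * q)
    (h₃ : n₃ = 3 * q * j + 2 * q + 2 * p) (hq : 0 < q) :
    (2 : ℝ) ^ j ≤ ((2 : ℝ) ^ ((3 * (q : ℝ) + 2 * p) / (3 * q))) ^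
      (1 / (1 - ((j : ℝ) * n₁) / (((j : ℝ) + 1) * n₃ + ((0 : ℕ) : ℝ)))) := by
  rw [← Real.rpow_mul (by norm_num : (0 : ℝ) ≤ 2), ← Real.rpow_natCast (2 : ℝ) j]
  exact Real.rpow_le_rpow_of_exponent_le (by norm_num : (1 : ℝ) ≤ 2)
    (nat_le_pencil_exponent p q j n₁ n₃ h₁ h₃ hq)

/-! ## The two entropy hypotheses along the pencil -/

set_option maxHeartbeats 800000 in
/-- **`H(Z_j) ≤ H(Y_j)` along the pencil** (`0 < q`, `p ≤ q`, `j ≥ 1000`, `j · δ(p/q) ≥ 30`): the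
hypothesis `hY` of `omegaRect_one_tw_exact` at `(n₁, n₂, n₃, n₄, 0, n₆)` bound by the count equations `h₁ … h₆`.
[cite: CoppersmithWinograd1990, §8] [cite: AlmanDuanVassilevskaWilliamsXuXuZhou2025, §3.4] -/
theorem paramY (p q j n₁ n₂ n₃ n₄ n₆ : ℕ) (hq : 0 < q) (hpq : p ≤ q) (hj : 1000 ≤ j)
    (hjδ : 30 ≤ (j : ℝ) * ((5 / 2 + (p : ℝ) / q) * Real.log 2 - 5 / 2 * Real.log (5 / 2)))
    (h₁ : n₁ = 3 * q * j + 2 * q) (h₂ : n₂ + (3 * q * j + 2 * q + 2 * p) = 2 * q * j * 2 ^ (j + 1))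
    (h₃ : n₃ = 3 * q * j + 2 * q + 2 * p) (h₄ : n₄ + 2 * q = q * j) (h₆ : n₆ = 2 * q * j) :
    shannonEntropy
        ![((n₁ : ℝ) + n₄ + (0 : ℕ)) /
            (n₁ + n₂ + n₃ + n₄ + 0 + n₆ : ℕ),
          ((n₂ : ℝ) + n₃) /
            (n₁ + n₂ + n₃ + n₄ + 0 + n₆ : ℕ),
          (n₆ : ℝ) / (n₁ + n₂ + n₃ + n₄ + 0 + n₆ : ℕ)] ≤
      shannonEntropy
        ![((n₃ : ℝ) + (0 : ℕ) + n₆) /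
            (n₁ + n₂ + n₃ + n₄ + 0 + n₆ : ℕ),
          ((n₁ : ℝ) + n₂) /
            (n₁ + n₂ + n₃ + n₄ + 0 + n₆ : ℕ),
          (n₄ : ℝ) / (n₁ + n₂ + n₃ + n₄ + 0 + n₆ : ℕ)] := by
  have hJ : (1000 : ℝ) ≤ (j : ℝ) := by exact_mod_cast hj
  have hq' : (0 : ℝ) < q := by exact_mod_cast hq
  have hpq' : (p : ℝ) ≤ q := by exact_mod_cast hpq
  have hjpos : (0 : ℝ) < j := by linarith
  have hB1 : (2 : ℝ) ^ 65 ≤ (2 : ℝ) ^ (j + 1) := pow_le_pow_right₀ (by norm_num) (by omega)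
  have hjB : (j : ℝ) ≤ (2 : ℝ) ^ (j + 1) := by
    have h := (Nat.lt_two_pow_self : j + 1 < 2 ^ (j + 1)).le
    have h' : ((j + 1 : ℕ) : ℝ) ≤ ((2 ^ (j + 1) : ℕ) : ℝ) := by exact_mod_cast h
    push_cast at h'
    linarith
  set B : ℝ := (2 : ℝ) ^ (j + 1) with hBdef
  set d : ℝ := B + 3 with hddef
  have hBpos : 0 < B := by positivity
  have hdpos : 0 < d := by positivity
  -- the counts as reals
  have c₁ : (n₁ : ℝ) = 3 * q * j + 2 * q := by rw [h₁]; push_cast; ring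
  have c₂ : (n₂ : ℝ) = 2 * q * j * B - (3 * q * j + 2 * q + 2 * p) := by
    have h := congrArg (Nat.cast : ℕ → ℝ) h₂
    push_cast at h
    rw [hBdef]; linarith
  have c₃ : (n₃ : ℝ) = 3 * q * j + 2 * q + 2 * p := by rw [h₃]; push_cast; ring
  have c₄ : (n₄ : ℝ) = q * j - 2 * q := by
    have h := congrArg (Nat.cast : ℕ → ℝ) h₄
    push_cast at h
    linarith
  have c₆ : (n₆ : ℝ) = 2 * q * j := by rw [h₆]; push_cast; ring
  have cN : ((n₁ + n₂ + n₃ + n₄ + 0 + n₆ : ℕ) : ℝ) = 2 * q * j * d := by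
    push_cast; rw [c₁, c₂, c₃, c₄, c₆, hddef]; ring
  have hNpos : (0 : ℝ) < 2 * q * j * d := by positivity
  -- the parameters of the core lemma
  set κ : ℝ := (p : ℝ) / q with hκdef
  set ε : ℝ := 1 / (j : ℝ) with hεdef
  have hκ0 : 0 ≤ κ := by positivity
  have hκ1 : κ ≤ 1 := by rw [hκdef, div_le_one hq']; exact hpq'
  have hε0 : 0 < ε := by positivity
  have hεle : ε ≤ 1 / 1000 := one_div_le_one_div_of_le (by norm_num) hJ
  have hεJ : ε * j = 1 := by rw [hεdef]; field_simp
  have hεδ : 30 * ε ≤ (5 / 2 + κ) * Real.log 2 - 5 / 2 * Real.log (5 / 2) := by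
    have h : 30 / (j : ℝ) ≤ (5 / 2 + κ) * Real.log 2 - 5 / 2 * Real.log (5 / 2) := by
      rw [div_le_iff₀' hjpos]; exact hjδ
    calc 30 * ε = 30 / (j : ℝ) := by rw [hεdef]; ring
      _ ≤ _ := h
  have hBε : 1 ≤ ε * B :=
    calc (1 : ℝ) = ε * j := hεJ.symm
      _ ≤ ε * B := mul_le_mul_of_nonneg_left hjB hε0.le
  have hlogB : Real.log B = ((j : ℝ) + 1) * Real.log 2 := by
    rw [hBdef, Real.log_pow]; push_cast; ring
  set α : ℝ := 5 / 2 + (1 + κ) * ε with hαdef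
  set γ : ℝ := 1 / 2 - ε with hγdef
  set τ : ℝ := 3 + κ * ε with hτdef
  -- the entries: `Z = (2, B, 1)/d`, `Y = (α, d − τ, γ)/d`
  have eZ0 : ((n₁ : ℝ) + n₄ + (0 : ℕ)) /
      (n₁ + n₂ + n₃ + n₄ + 0 + n₆ : ℕ) = 2 / d := by
    rw [cN, c₁, c₄]; push_cast; field_simp; ring
  have eZ1 : ((n₂ : ℝ) + n₃) /
      (n₁ + n₂ + n₃ + n₄ + 0 + n₆ : ℕ) = B / d := by
    rw [cN, c₂, c₃]; field_simp; ring
  have eZ2 : (n₆ : ℝ) / (n₁ + n₂ + n₃ + n₄ + 0 + n₆ : ℕ) =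
      1 / d := by
    rw [cN, c₆]; field_simp
  have eY0 : ((n₃ : ℝ) + (0 : ℕ) + n₆) /
      (n₁ + n₂ + n₃ + n₄ + 0 + n₆ : ℕ) = α / d := by
    rw [cN, c₃, c₆, hαdef, hκdef, hεdef]; push_cast; field_simp; ring
  have eY1 : ((n₁ : ℝ) + n₂) /
      (n₁ + n₂ + n₃ + n₄ + 0 + n₆ : ℕ) = 1 - τ / d := by
    rw [cN, c₁, c₂, hτdef, hκdef, hεdef]; field_simp; ring
  have eY2 : (n₄ : ℝ) / (n₁ + n₂ + n₃ + n₄ + 0 + n₆ : ℕ) =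
      γ / d := by
    rw [cN, c₄, hγdef, hεdef]; field_simp; try ring
  rw [eZ0, eZ1, eZ2, eY0, eY1, eY2]
  have hlog2 : 0 < Real.log 2 := Real.log_pos one_lt_two
  rw [shannonEntropy_def, shannonEntropy_def, div_le_div_iff_of_pos_right hlog2]
  simp only [Fin.sum_univ_three, Matrix.cons_val_zero, Matrix.cons_val_one, Matrix.cons_val_two,
    Matrix.head_cons, Matrix.tail_cons]
  exact coreY κ ε j B d α γ τ hκ0 hκ1 hε0 hεle hεJ hεδ hB1 hBε hlogB hddef hαdef hγdef hτdef

set_option maxHeartbeats 800000 in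
/-- **`H(Z_j) ≤ H(X_j)` along the pencil** (same regime): the hypothesis `hX` of
`omegaRect_one_tw_exact` at `(n₁, n₂, n₃, n₄, 0, n₆)` bound by the count equations `h₁ … h₆`.
[cite: CoppersmithWinograd1990, §8] [cite: AlmanDuanVassilevskaWilliamsXuXuZhou2025, §3.4] -/
theorem paramX (p q j n₁ n₂ n₃ n₄ n₆ : ℕ) (hq : 0 < q) (hpq : p ≤ q) (hj : 1000 ≤ j)
    (hjδ : 30 ≤ (j : ℝ) * ((5 / 2 + (p : ℝ) / q) * Real.log 2 - 5 / 2 * Real.log (5 / 2)))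
    (h₁ : n₁ = 3 * q * j + 2 * q) (h₂ : n₂ + (3 * q * j + 2 * q + 2 * p) = 2 * q * j * 2 ^ (j + 1))
    (h₃ : n₃ = 3 * q * j + 2 * q + 2 * p) (h₄ : n₄ + 2 * q = q * j) (h₆ : n₆ = 2 * q * j) :
    shannonEntropy
        ![((n₁ : ℝ) + n₄ + (0 : ℕ)) /
            (n₁ + n₂ + n₃ + n₄ + 0 + n₆ : ℕ),
          ((n₂ : ℝ) + n₃) /
            (n₁ + n₂ + n₃ + n₄ + 0 + n₆ : ℕ),
          (n₆ : ℝ) / (n₁ + n₂ + n₃ + n₄ + 0 + n₆ : ℕ)] ≤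
      shannonEntropy
        ![((n₂ : ℝ) + n₄ + n₆) /
            (n₁ + n₂ + n₃ + n₄ + 0 + n₆ : ℕ),
          ((n₁ : ℝ) + n₃) /
            (n₁ + n₂ + n₃ + n₄ + 0 + n₆ : ℕ),
          ((0 : ℕ) : ℝ) / (n₁ + n₂ + n₃ + n₄ + 0 + n₆ : ℕ)] := by
  have hJ : (1000 : ℝ) ≤ (j : ℝ) := by exact_mod_cast hj
  have hq' : (0 : ℝ) < q := by exact_mod_cast hq
  have hpq' : (p : ℝ) ≤ q := by exact_mod_cast hpq
  have hjpos : (0 : ℝ) < j := by linarith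
  have hB1 : (2 : ℝ) ^ 65 ≤ (2 : ℝ) ^ (j + 1) := pow_le_pow_right₀ (by norm_num) (by omega)
  have hjB : (j : ℝ) ≤ (2 : ℝ) ^ (j + 1) := by
    have h := (Nat.lt_two_pow_self : j + 1 < 2 ^ (j + 1)).le
    have h' : ((j + 1 : ℕ) : ℝ) ≤ ((2 ^ (j + 1) : ℕ) : ℝ) := by exact_mod_cast h
    push_cast at h'
    linarith
  set B : ℝ := (2 : ℝ) ^ (j + 1) with hBdef
  set d : ℝ := B + 3 with hddef
  have hBpos : 0 < B := by positivity
  have hdpos : 0 < d := by positivity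
  -- the counts as reals
  have c₁ : (n₁ : ℝ) = 3 * q * j + 2 * q := by rw [h₁]; push_cast; ring
  have c₂ : (n₂ : ℝ) = 2 * q * j * B - (3 * q * j + 2 * q + 2 * p) := by
    have h := congrArg (Nat.cast : ℕ → ℝ) h₂
    push_cast at h
    rw [hBdef]; linarith
  have c₃ : (n₃ : ℝ) = 3 * q * j + 2 * q + 2 * p := by rw [h₃]; push_cast; ring
  have c₄ : (n₄ : ℝ) = q * j - 2 * q := by
    have h := congrArg (Nat.cast : ℕ → ℝ) h₄
    push_cast at h
    linarith
  have c₆ : (n₆ : ℝ) = 2 * q * j := by rw [h₆]; push_cast; ring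
  have cN : ((n₁ + n₂ + n₃ + n₄ + 0 + n₆ : ℕ) : ℝ) = 2 * q * j * d := by
    push_cast; rw [c₁, c₂, c₃, c₄, c₆, hddef]; ring
  have hNpos : (0 : ℝ) < 2 * q * j * d := by positivity
  -- the parameters of the core lemma
  set κ : ℝ := (p : ℝ) / q with hκdef
  set ε : ℝ := 1 / (j : ℝ) with hεdef
  have hκ0 : 0 ≤ κ := by positivity
  have hκ1 : κ ≤ 1 := by rw [hκdef, div_le_one hq']; exact hpq'
  have hε0 : 0 < ε := by positivity
  have hεle : ε ≤ 1 / 1000 := one_div_le_one_div_of_le (by norm_num) hJ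
  have hεJ : ε * j = 1 := by rw [hεdef]; field_simp
  have hεδ : 30 * ε ≤ (5 / 2 + κ) * Real.log 2 - 5 / 2 * Real.log (5 / 2) := by
    have h : 30 / (j : ℝ) ≤ (5 / 2 + κ) * Real.log 2 - 5 / 2 * Real.log (5 / 2) := by
      rw [div_le_iff₀' hjpos]; exact hjδ
    calc 30 * ε = 30 / (j : ℝ) := by rw [hεdef]; ring
      _ ≤ _ := h
  have hBε : 1 ≤ ε * B :=
    calc (1 : ℝ) = ε * j := hεJ.symm
      _ ≤ ε * B := mul_le_mul_of_nonneg_left hjB hε0.le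
  have hlogB : Real.log B = ((j : ℝ) + 1) * Real.log 2 := by
    rw [hBdef, Real.log_pow]; push_cast; ring
  set σ : ℝ := 3 + (2 + κ) * ε with hσdef
  -- the entries: `Z = (2, B, 1)/d`, `X = (d − σ, σ, 0)/d`
  have eZ0 : ((n₁ : ℝ) + n₄ + (0 : ℕ)) /
      (n₁ + n₂ + n₃ + n₄ + 0 + n₆ : ℕ) = 2 / d := by
    rw [cN, c₁, c₄]; push_cast; field_simp; ring
  have eZ1 : ((n₂ : ℝ) + n₃) /
      (n₁ + n₂ + n₃ + n₄ + 0 + n₆ : ℕ) = B / d := by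
    rw [cN, c₂, c₃]; field_simp; ring
  have eZ2 : (n₆ : ℝ) / (n₁ + n₂ + n₃ + n₄ + 0 + n₆ : ℕ) =
      1 / d := by
    rw [cN, c₆]; field_simp
  have eX0 : ((n₂ : ℝ) + n₄ + n₆) /
      (n₁ + n₂ + n₃ + n₄ + 0 + n₆ : ℕ) = 1 - σ / d := by
    rw [cN, c₂, c₄, c₆, hσdef, hκdef, hεdef]; field_simp; ring
  have eX1 : ((n₁ : ℝ) + n₃) /
      (n₁ + n₂ + n₃ + n₄ + 0 + n₆ : ℕ) = σ / d := by
    rw [cN, c₁, c₃, hσdef, hκdef, hεdef]; field_simp; ring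
  have eX2 : ((0 : ℕ) : ℝ) / (n₁ + n₂ + n₃ + n₄ + 0 + n₆ : ℕ) =
      0 := by simp
  rw [eZ0, eZ1, eZ2, eX0, eX1, eX2]
  have hlog2 : 0 < Real.log 2 := Real.log_pos one_lt_two
  rw [shannonEntropy_def, shannonEntropy_def, div_le_div_iff_of_pos_right hlog2]
  simp only [Fin.sum_univ_three, Matrix.cons_val_zero, Matrix.cons_val_one, Matrix.cons_val_two,
    Matrix.head_cons, Matrix.tail_cons, Real.negMulLog_zero, add_zero]
  exact coreX κ ε j B d σ hκ0 hκ1 hε0 hεle hεJ hεδ hB1 hBε hlogB hddef hσdef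

end Summit.MatrixMultiplication.MatrixMultiplication.Theorems.SaturationLadderTwinCeilingPencil
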